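import Summits.QuantumFields.YangMills.Theorems.IRcofAdaptedSpectralData
import Summits.QuantumFields.YangMills.Theorems.IR.DeconfinementRulerHelpers
import Summits.QuantumFields.YangMills.Theorems.BalabanLadderIRcofCentreFinite
import Summits.QuantumFields.YangMills.Theorems.BalabanLadderIRRankPurityCofinalDefs
import Summits.QuantumFields.YangMills.Theorems.IR.RunningLandmarkDefs
import Summits.QuantumFields.YangMills.Theses.BalabanLadder
import Literature.MathematicalPhysics.QuantumFieldTheory.WilsonFinTorusTwistedPartitionSwap
import Literature.MathematicalPhysics.QuantumFieldTheory.WilsonFinTorusPartitionSymmetry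
import Literature.MathematicalPhysics.QuantumFieldTheory.WilsonFinTorusSpectralData
import HarnessLib

/-!
# Line `inplane-squaring-ladder` v1_2 for crux `IRcof` (stmt-QuantumFields-26930) — SUPPLIER ARROW #3

v1_2 = v1_1 (sha16 28ecc8f5a6710839) with the stub (Σ′) `stub_adaptedSpectralData` DISCHARGED on the helper lane:
✓p818348 `Theorems/IRcofAdaptedSpectralDataCore.lean` (def-free mathematics) + ✓p818549 `Theorems/IRcofAdaptedSpectralData.lean`
(`Theorems.IRcofInplaneSquaringLadderLine.stub_adaptedSpectralData : AdaptedSpectralData` over VERBATIM copies of §0b/§1's `tw0`, `P0`,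
`u0`, `FluxSubmultAt`, `AdaptedSpectralDataAt`, `AdaptedSpectralData` — δ-definitionally THIS file's stub type; crit-1 custody
PROBE-cut9b-custody 6e450f21f2ac5c74). FIVE stubs remain: (S) `stub_seed` (load-bearing, E-type, width 0), (R) `stub_residuals`,
(V) `stub_neutralPure` (declared residual), (CF) `stub_centreFreePX` (X11 declared), (N) `stub_irnscCof` (shared). Nothing else changed.

v1_1 = v1 (sha16 2d7939aac1b7e59b) + the critic's CUT-9 fixes (‼V′ named line parameters with quadratic book-keeping,
‼T the β = 0 toy in bytes, `PXcof` namespaced); stub NAMES and the TYPES of (S), (Σ′), (CF), (N) are byte-identical to v1,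
(R) and (V) differ from v1 only in their constants (`ebar`, `θV`, `θN`).

Skeleton form of lens-1 g2 card «inplane-squaring-ladder» (Ideas/inplane-squaring-ladder.md): the F-half of row 2's
(G) `ConfinementHeredityUp` becomes a THEOREM modulo the located operator lemma (Σ) and near-wall residuals.

THE LEVER: for the flux weight `u := 1 − P/Z` of one temporal plane (P = `⟨g⟩`-average of (0,3)-twisted partition
functions), doubling an in-plane side SQUARES u (`u(2τ) ≤ u(τ)²·R`), while doubling a transverse side at most DOUBLES
it. One octave maps `u ↦ gmap u ebar = (8u² + 3u + 3·ebar)² · 6/5` below the ignition threshold u ≤ 1/32: margin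
confinement of ONE cold 4:1 box ignites SUPER-geometric decay up the pinned ladder (quadratic rows
1/32 ↦ 1/80 ↦ 1/500 ↦ 1/20000 ↦ 3·10⁻⁸ ↦ 2·10⁻¹³ in K = 5 octaves), and the seam `coldDefect ≤ θN + 2u` turns neutral
purity into THE NUMBER 1/24.

## STUBS (six)

* `stub_seed : Seed` — (S) one margin-confined cold 4:1 box cofinally; UNDECIDED / E-type / INSTRUMENTABLE.
* `stub_adaptedSpectralData : AdaptedSpectralData` — centre-adapted spectral data of the slice transfer operator;
  ATTACKABLE (M) / prover-closable (functional analysis: adapted eigenbasis or charged-operator kernel). This is the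
  residual of (Σ) FluxSubmult via the proved `fluxSubmult_of_adaptedSpectralData`.
* `stub_residuals : Residuals` — (R) near-wall tolerances (R1–R4); UNDECIDED / idle above seed octave.
* `stub_neutralPure : NeutralPure` — (V) neutral gap given deep confinement; UNDECIDED / E-type / centre-blind.
* `stub_centreFreePX : CentreFreePX` — (CF) PXcof(1/24) for centre-free G; BARRIER (X11).
* `stub_irnscCof : IRnscCof` — (N) shared from line of record `pinned_cofinal_bill`; π₁ ≠ 1 conjunct.

## COMPOSITION

`IRcof_of : Seed → AdaptedSpectralData → Residuals → NeutralPure → CentreFreePX → IRnscCof → BalabanLadder.IRcof`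
(kernel-checked, via `fluxSubmult_of_adaptedSpectralData`, `pxcof24_of_pieces`, `cofinalGapOn_of_pinnedExits`).

## LINE PARAMETERS AND THE V-THRESHOLD (v1_1; crit-1 CUT-7 ‼V, CUT-9 ‼V′)

The thresholds ARE line parameters here (§0): `θV = 10⁻¹²` (the (V) gate on the flux weight), `θN = 1/60` (the neutral
purity defect (V) grants), `ebar = 10⁻⁷` (the additive tolerance of (R2), (R3)), `K = 5` octaves; they enter the stubs
ONLY through these names, and the composition uses their values ONLY in `rows` and `seam_closes` (certified by
`norm_num`; cf. the critic's `ARITH-cut9-repair.lean` 4d057613f2efd005).  Why these values (INFO-class, SU(2)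
phenomenology, not kernel content): v1's gate `u0 ≤ 1/400` sits at `T ≈ 0.8–0.85 T_c`, where the neutral (glueball-pair ∕
transverse-flux) impurity of the `(4t)³ × t → 2t` doubling is `≈ 0.2 ≫ 1/60`, so (V) as typed in v1 was suspect-false at
its boundary; `59/60` purity needs `m_G/T ≳ 10`, i.e. `T ≲ 0.55 T_c`, i.e. `u0 ≲ 10⁻⁹…10⁻¹⁰`; `θV = 10⁻¹²` (`T ≲ 0.5 T_c`)
is on the safe side, and the quadratic ladder reaches it from the seed `1/32` in the SAME five octaves
(`u₅ ≤ 2·10⁻¹³`).  `ebar = 10⁻⁷` is idle above the seed octave (sideways impurities at k ≥ 1 are `≲ e^{−4 m t_k}`).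
A retune is a change of §0 and of the two `norm_num` certificates, nothing else.

Does NOT displace the line of record `pinned_cofinal_bill.lean` d3255819134117aa; this is SUPPLIER ARROW #3.

HONEST FRAMING: nothing here proves the Yang–Mills mass gap (Clay), IRcof, IR, or any leg; the stubs carry ALL the
content; finite-volume / conditional.
-/

set_option autoImplicit false

noncomputable section

open Filter Topology MeasureTheory
open scoped BigOperators
open Literature.MathematicalPhysics.QuantumFieldTheory Literature.MathematicalPhysics.QuantumLattice
open Summit.QuantumFields.YangMills.Cruxes.OSLegsFromFemtoAndGap.DlrCollarTransfer (LowerBounds)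
open Summit.QuantumFields.YangMills.Cruxes.IR.ColdPurityBridge (coldDefect)
open Summit.QuantumFields.YangMills.Cruxes.IR.RankPurity (IRnscCof)
open Summit.QuantumFields.YangMills.Cruxes.IR.PinnedExitCofinal (cofinalGapOn_of_pinnedExits)
open Summit.QuantumFields.YangMills.Cruxes.IRcof.RunningLandmark (PinnedExitsCofinalAt)
open Summit.QuantumFields.YangMills.Cruxes.IR.TwistCost (twistedPartition_le)

namespace Summit.QuantumFields.YangMills.Cruxes.IRcof.Lines.InplaneSquaringLadder

/-- **PXcof(θ)** — alias for the slot body `PinnedExitsCofinalAt θ` (VERBATIM). -/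
abbrev PXcof := PinnedExitsCofinalAt

/-! ## §0 LINE PARAMETERS (crit-1 CUT-9 ‼V′ repair demo): (θ_V, θ_N, ē, K) = (10⁻¹², 1/60, 10⁻⁷, 5)

`θV` = the (V) gate on the flux weight u0 (INFO: ↔ T ≲ 0.5 T_c for SU(2)); `θN` = the neutral purity defect allowed by (V);
`ebar` = the additive tolerance of (R2),(R3). They appear below ONLY through these names; the composition's five quadratic rows
(`rows`) and the seam (`seam_closes`) are the only places their values are used. -/

/-- (V) gate θ_V = 10⁻¹². -/
def θV : ℝ := 1 / 10 ^ 12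

/-- (V) purity defect θ_N = 1/60. -/
def θN : ℝ := 1 / 60

/-- (R2),(R3) additive tolerance ē = 10⁻⁷. -/
def ebar : ℝ := 1 / 10 ^ 7

theorem ebar_nonneg : (0 : ℝ) ≤ ebar := by unfold ebar; positivity

theorem θN_nonneg : (0 : ℝ) ≤ θN := by unfold θN; positivity

/-- The octave map of the ladder (see `arith_octave`). -/
def gmap (u e : ℝ) : ℝ := (8 * u ^ 2 + 3 * u + 3 * e) ^ 2 * (6 / 5)

theorem gmap_mono {u v e : ℝ} (hu : 0 ≤ u) (huv : u ≤ v) (he : 0 ≤ e) : gmap u e ≤ gmap v e := by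
  unfold gmap
  have h1 : 0 ≤ 8 * u ^ 2 + 3 * u + 3 * e := by positivity
  have h2 : 8 * u ^ 2 + 3 * u + 3 * e ≤ 8 * v ^ 2 + 3 * v + 3 * e := by nlinarith
  have := pow_le_pow_left₀ h1 h2 2
  nlinarith

/-- The five QUADRATIC rows (v1_1; they replace v1's linear `u/2 + ē/2` book-keeping): 1/32 ↦ 1/80 ↦ 1/500 ↦ 1/20000 ↦ 3·10⁻⁸ ↦ 2·10⁻¹³. -/
theorem rows : gmap (1 / 32) ebar ≤ 1 / 80 ∧ gmap (1 / 80) ebar ≤ 1 / 500 ∧ gmap (1 / 500) ebar ≤ 1 / 20000 ∧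
    gmap (1 / 20000) ebar ≤ 3 / 10 ^ 8 ∧ gmap (3 / 10 ^ 8) ebar ≤ 2 / 10 ^ 13 := by
  unfold gmap ebar; norm_num

/-- The seam closes with the parameters: θ_N + 2·(2·10⁻¹³) ≤ 1/24 and 2·10⁻¹³ ≤ θ_V. -/
theorem seam_closes : θN + 2 * (2 / 10 ^ 13) ≤ 1 / 24 ∧ (2 / 10 ^ 13 : ℝ) ≤ θV := by
  unfold θN θV; norm_num

/-! ## §0a Arithmetic (pure ℝ lemmas, no type-class dependencies) -/

theorem arith_transverse {Z₁ Z₂ P₁ P₂ e : ℝ} (hZ₁ : 0 < Z₁) (hZ₂ : 0 < Z₂) (hP₁0 : 0 ≤ P₁) (hP₁ : P₁ ≤ Z₁)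
    (hP₂0 : 0 ≤ P₂) (he : 0 ≤ e) (hdbl : Z₂ ≤ Z₁ ^ 2) (hres : (1 - e) * P₁ ^ 2 ≤ P₂) :
    1 - P₂ / Z₂ ≤ 2 * (1 - P₁ / Z₁) + e := by
  have hq : P₁ / Z₁ ≤ 1 := by rwa [div_le_one hZ₁]
  have hq0 : 0 ≤ P₁ / Z₁ := div_nonneg hP₁0 hZ₁.le
  have h1 : P₂ / Z₁ ^ 2 ≤ P₂ / Z₂ := div_le_div_of_nonneg_left hP₂0 hZ₂ hdbl
  have h2 : (1 - e) * (P₁ / Z₁) ^ 2 ≤ P₂ / Z₁ ^ 2 := by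
    rw [div_pow, ← mul_div_assoc]; exact div_le_div_of_nonneg_right hres (by positivity)
  have h3 : 0 ≤ e * (1 - (P₁ / Z₁) ^ 2) := mul_nonneg he (by nlinarith)
  nlinarith [sq_nonneg (P₁ / Z₁ - 1)]

theorem arith_inplane {Z₁ Z₂ P₁ P₂ 𝒩 : ℝ} (hZ₁ : 0 < Z₁) (hZ₂ : 0 < Z₂)
    (hsub : Z₂ - P₂ ≤ (Z₁ - P₁) ^ 2) (hres : Z₁ ^ 2 ≤ 𝒩 * Z₂) :
    1 - P₂ / Z₂ ≤ (1 - P₁ / Z₁) ^ 2 * 𝒩 := by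
  have e1 : 1 - P₂ / Z₂ = (Z₂ - P₂) / Z₂ := by field_simp
  have e2 : 1 - P₁ / Z₁ = (Z₁ - P₁) / Z₁ := by field_simp
  rw [e1, e2, div_le_iff₀ hZ₂]
  calc Z₂ - P₂ ≤ (Z₁ - P₁) ^ 2 := hsub
    _ = ((Z₁ - P₁) / Z₁) ^ 2 * Z₁ ^ 2 := by field_simp
    _ ≤ ((Z₁ - P₁) / Z₁) ^ 2 * (𝒩 * Z₂) := mul_le_mul_of_nonneg_left hres (sq_nonneg _)
    _ = ((Z₁ - P₁) / Z₁) ^ 2 * 𝒩 * Z₂ := by ring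

theorem arith_seam {Z₁ Z₂ P₁ P₂ θ : ℝ} (hZ₁ : 0 < Z₁) (hP₁0 : 0 ≤ P₁) (hP₁ : P₁ ≤ Z₁)
    (hP₂ : P₂ ≤ Z₂) (hθ : 0 ≤ θ) (hV : (1 - θ) * P₁ ^ 2 ≤ P₂) :
    1 - Z₂ / Z₁ ^ 2 ≤ θ + 2 * (1 - P₁ / Z₁) := by
  have hq : P₁ / Z₁ ≤ 1 := by rwa [div_le_one hZ₁]
  have hq0 : 0 ≤ P₁ / Z₁ := div_nonneg hP₁0 hZ₁.le
  have h2 : (1 - θ) * (P₁ / Z₁) ^ 2 ≤ Z₂ / Z₁ ^ 2 := by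
    rw [div_pow, ← mul_div_assoc]; exact div_le_div_of_nonneg_right (hV.trans hP₂) (by positivity)
  have h3 : 0 ≤ θ * (1 - (P₁ / Z₁) ^ 2) := mul_nonneg hθ (by nlinarith)
  nlinarith [sq_nonneg (P₁ / Z₁ - 1)]

theorem arith_octave {u u₁ u₂ u₃ u₄ e : ℝ} (_hu : 0 ≤ u) (hu₃ : 0 ≤ u₃) (_he : 0 ≤ e)
    (h1 : u₁ ≤ u ^ 2 * 2) (h2 : u₂ ≤ 2 * u₁ + (u + e)) (h3 : u₃ ≤ 2 * u₂ + (u + e))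
    (h4 : u₄ ≤ u₃ ^ 2 * (6 / 5)) :
    u₄ ≤ (8 * u ^ 2 + 3 * u + 3 * e) ^ 2 * (6 / 5) := by
  have h3' : u₃ ≤ 8 * u ^ 2 + 3 * u + 3 * e := by nlinarith
  have h5 : u₃ ^ 2 ≤ (8 * u ^ 2 + 3 * u + 3 * e) ^ 2 := pow_le_pow_left₀ hu₃ h3' 2
  nlinarith


/-! ## §0b Currency: the (0,3)-twist family, P0, u0 (inlined from sheet) -/

section Currency

variable {G : Type} [Group G] [TopologicalSpace G] [IsTopologicalGroup G] [CompactSpace G]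
  [MeasurableSpace G] [BorelSpace G]

/-- The temporal twist family «g on the plane (0,3), nothing else»: (g, 1, 1, 1). -/
def tw0 (g : G) : Fin 4 → G := Function.update (1 : Fin 4 → G) 0 g

variable {N : ℕ}

/-- The direction-0-NEUTRAL partition function: n⁻¹ Σ_{e<n} Z^{(gᵉ on (0,3))}. -/
def P0 (ρ : G →* Matrix (Fin N) (Fin N) ℂ) (β : ℝ) (g : G) (n : ℕ) (a b c d : ℕ) : ℝ :=
  (n : ℝ)⁻¹ * ∑ e : Fin n, wilsonFinTorusTwistedPartition ρ β (tw0 (g ^ (e : ℕ))) a b c d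

/-- The flux weight: u = 1 − P0/Z (the Gibbs weight of the direction-0-charged flux sectors). -/
def u0 (ρ : G →* Matrix (Fin N) (Fin N) ℂ) (β : ℝ) (g : G) (n : ℕ) (a b c d : ℕ) : ℝ :=
  1 - P0 ρ β g n a b c d / wilsonFinTorusPartition ρ β a b c d

/-- Flux-sector sub-multiplicativity at one configuration. -/
def FluxSubmultAt (ρ : G →* Matrix (Fin N) (Fin N) ℂ) (β : ℝ) (g : G) (n : ℕ) : Prop :=
  ∀ a b c d : ℕ, 1 ≤ a → 1 ≤ b → 1 ≤ c → 2 ≤ d →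
    wilsonFinTorusPartition ρ β a b c (2 * d) - P0 ρ β g n a b c (2 * d) ≤
      (wilsonFinTorusPartition ρ β a b c d - P0 ρ β g n a b c d) ^ 2

/-! ### Helper lemmas for the five-octave ladder (inlined from sheet) -/

omit [TopologicalSpace G] [IsTopologicalGroup G] [CompactSpace G] [MeasurableSpace G] [BorelSpace G] in
theorem tw0_apply_zero (g : G) : tw0 g 0 = g := by simp [tw0]

omit [TopologicalSpace G] [IsTopologicalGroup G] [CompactSpace G] [MeasurableSpace G] [BorelSpace G] in
theorem tw0_apply_of_ne (g : G) {μ : Fin 4} (h : μ ≠ 0) : tw0 g μ = 1 := by simp [tw0, h]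

omit [TopologicalSpace G] [IsTopologicalGroup G] [CompactSpace G] [MeasurableSpace G] [BorelSpace G] in
theorem tw0_center {g : G} (hg : g ∈ Subgroup.center G) (μ : Fin 4) : tw0 g μ ∈ Subgroup.center G := by
  rcases eq_or_ne μ 0 with rfl | h
  · rw [tw0_apply_zero]; exact hg
  · rw [tw0_apply_of_ne g h]; exact Subgroup.one_mem _

omit [TopologicalSpace G] [IsTopologicalGroup G] [CompactSpace G] [MeasurableSpace G] [BorelSpace G] in
theorem tw0_pow_inv (g : G) (e : ℕ) : Function.update (1 : Fin 4 → G) 0 (g ^ e)⁻¹ = tw0 (g⁻¹ ^ e) := by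
  rw [tw0, inv_pow]

variable [SecondCountableTopology G] {ρ : G →* Matrix (Fin N) (Fin N) ℂ}

theorem P0_pos (hρ : Continuous ρ) (β : ℝ) (g : G) {n : ℕ} (hn : 0 < n) (a b c d : ℕ) :
    0 < P0 ρ β g n a b c d := by
  unfold P0
  haveI : Nonempty (Fin n) := ⟨⟨0, hn⟩⟩
  refine mul_pos (inv_pos.2 (by exact_mod_cast hn)) (Finset.sum_pos (fun e _ => ?_) Finset.univ_nonempty)
  exact wilsonFinTorusTwistedPartition_pos ρ hρ β _ a b c d

theorem P0_le_Z (hρ : Continuous ρ) (hρu : ∀ x, ρ x ∈ Matrix.unitaryGroup (Fin N) ℂ) {β : ℝ} (hβ : 0 ≤ β)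
    {g : G} (hg : g ∈ Subgroup.center G) {n : ℕ} (hn : 0 < n) (a b c : ℕ) {d : ℕ} (hd : 2 ≤ d) :
    P0 ρ β g n a b c d ≤ wilsonFinTorusPartition ρ β a b c d := by
  obtain ⟨m, rfl⟩ : ∃ m, d = m + 2 := ⟨d - 2, by omega⟩
  unfold P0
  have hle : ∀ e : Fin n, wilsonFinTorusTwistedPartition ρ β (tw0 (g ^ (e : ℕ))) a b c (m + 2) ≤
      wilsonFinTorusPartition ρ β a b c (m + 2) := fun e =>
    twistedPartition_le hρ hρu hβ a b c m (tw0_center (Subgroup.pow_mem _ hg _))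
  have hn' : (0 : ℝ) < n := by exact_mod_cast hn
  calc (n : ℝ)⁻¹ * ∑ e : Fin n, wilsonFinTorusTwistedPartition ρ β (tw0 (g ^ (e : ℕ))) a b c (m + 2)
      ≤ (n : ℝ)⁻¹ * ∑ _e : Fin n, wilsonFinTorusPartition ρ β a b c (m + 2) :=
        mul_le_mul_of_nonneg_left (Finset.sum_le_sum fun e _ => hle e) (inv_nonneg.2 hn'.le)
    _ = wilsonFinTorusPartition ρ β a b c (m + 2) := by
        rw [Finset.sum_const, Finset.card_univ, Fintype.card_fin, nsmul_eq_mul, ← mul_assoc,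
          inv_mul_cancel₀ hn'.ne', one_mul]

theorem u0_nonneg (hρ : Continuous ρ) (hρu : ∀ x, ρ x ∈ Matrix.unitaryGroup (Fin N) ℂ) {β : ℝ} (hβ : 0 ≤ β)
    {g : G} (hg : g ∈ Subgroup.center G) {n : ℕ} (hn : 0 < n) (a b c : ℕ) {d : ℕ} (hd : 2 ≤ d) :
    0 ≤ u0 ρ β g n a b c d := by
  unfold u0
  rw [sub_nonneg, div_le_one (wilsonFinTorusPartition_pos hρ β a b c d)]
  exact P0_le_Z hρ hρu hβ hg hn a b c hd

theorem u0_le_of_margins (hρ : Continuous ρ) (β : ℝ) {g : G} (hg : g ∈ Subgroup.center G) {n : ℕ} (hn : 0 < n)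
    (a b c d : ℕ) {η : ℝ}
    (hm : ∀ z : Fin 4 → G, (∀ μ, z μ ∈ Subgroup.center G) →
      1 - wilsonFinTorusTwistedPartition ρ β z a b c d / wilsonFinTorusPartition ρ β a b c d ≤ η) :
    u0 ρ β g n a b c d ≤ η := by
  have hZ := wilsonFinTorusPartition_pos hρ β a b c d
  have hn' : (0 : ℝ) < n := by exact_mod_cast hn
  have he : ∀ e : Fin n, 1 - wilsonFinTorusTwistedPartition ρ β (tw0 (g ^ (e : ℕ))) a b c d /
      wilsonFinTorusPartition ρ β a b c d ≤ η := fun e => hm _ (tw0_center (Subgroup.pow_mem _ hg _))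
  have hsum : ∑ e : Fin n, (1 - wilsonFinTorusTwistedPartition ρ β (tw0 (g ^ (e : ℕ))) a b c d /
      wilsonFinTorusPartition ρ β a b c d) ≤ ∑ _e : Fin n, η := Finset.sum_le_sum fun e _ => he e
  rw [Finset.sum_const, Finset.card_univ, Fintype.card_fin, nsmul_eq_mul, Finset.sum_sub_distrib, Finset.sum_const,
    Finset.card_univ, Fintype.card_fin, nsmul_eq_mul, mul_one, ← Finset.sum_div] at hsum
  unfold u0 P0
  have key : 1 - (n : ℝ)⁻¹ * (∑ e : Fin n, wilsonFinTorusTwistedPartition ρ β (tw0 (g ^ (e : ℕ))) a b c d) /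
      wilsonFinTorusPartition ρ β a b c d =
      (n : ℝ)⁻¹ * ((n : ℝ) - (∑ e : Fin n, wilsonFinTorusTwistedPartition ρ β (tw0 (g ^ (e : ℕ))) a b c d) /
        wilsonFinTorusPartition ρ β a b c d) := by field_simp
  rw [key]
  calc (n : ℝ)⁻¹ * ((n : ℝ) - (∑ e : Fin n, wilsonFinTorusTwistedPartition ρ β (tw0 (g ^ (e : ℕ))) a b c d) /
        wilsonFinTorusPartition ρ β a b c d) ≤ (n : ℝ)⁻¹ * ((n : ℝ) * η) :=
        mul_le_mul_of_nonneg_left hsum (inv_nonneg.2 hn'.le)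
    _ = η := by field_simp

omit [SecondCountableTopology G] in
theorem P0_swap03 (hρ : Continuous ρ) (β : ℝ) (g : G) (n : ℕ) (a b c d : ℕ) :
    P0 ρ β g n a b c d = P0 ρ β g⁻¹ n d b c a := by
  unfold P0
  congr 1
  refine Finset.sum_congr rfl fun e _ => ?_
  rw [tw0, wilsonFinTorusTwistedPartition_swap03_update ρ hρ β, tw0_pow_inv]

omit [SecondCountableTopology G] in
theorem u0_swap03 (hρ : Continuous ρ) (β : ℝ) (g : G) (n : ℕ) (a b c d : ℕ) :
    u0 ρ β g n a b c d = u0 ρ β g⁻¹ n d b c a := by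
  unfold u0
  rw [P0_swap03 hρ, wilsonFinTorusPartition_swap03 ρ hρ β a b c d]

/-! ### Untwisted doubling lemmas -/

theorem Z_double3_le_sq (hρ : Continuous ρ) (hρu : ∀ x, ρ x ∈ Matrix.unitaryGroup (Fin N) ℂ) {β : ℝ} (hβ : 0 ≤ β)
    (a b c : ℕ) {d : ℕ} (hd : 2 ≤ d) :
    wilsonFinTorusPartition ρ β a b c (2 * d) ≤ wilsonFinTorusPartition ρ β a b c d ^ 2 := by
  obtain ⟨s, _, lam, i₀, hle, -, -, hZ⟩ := exists_spectralData_wilsonFinTorusPartition_box hρ hρu hβ a b c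
  obtain ⟨m, rfl⟩ : ∃ m, d = m + 2 := ⟨d - 2, by omega⟩
  have h1 := hZ m
  have h2 : HasSum (fun i => (lam i ^ (m + 2)) ^ 2) (wilsonFinTorusPartition ρ β a b c (2 * (m + 2))) := by
    have h := hZ (2 * m + 2)
    rw [show 2 * m + 2 + 2 = 2 * (m + 2) from by ring] at h
    refine h.congr_fun fun i => ?_
    rw [← pow_mul, mul_comm]
  exact hasSum_sq_le_sq (fun i => pow_nonneg (hle i).1 _) h1 h2

theorem Z_double0_le_sq (hρ : Continuous ρ) (hρu : ∀ x, ρ x ∈ Matrix.unitaryGroup (Fin N) ℂ) {β : ℝ} (hβ : 0 ≤ β)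
    {a : ℕ} (ha : 2 ≤ a) (b c d : ℕ) :
    wilsonFinTorusPartition ρ β (2 * a) b c d ≤ wilsonFinTorusPartition ρ β a b c d ^ 2 := by
  rw [wilsonFinTorusPartition_swap03 ρ hρ β (2 * a) b c d, wilsonFinTorusPartition_swap03 ρ hρ β a b c d]
  exact Z_double3_le_sq hρ hρu hβ d b c ha

theorem Z_double1_le_sq (hρ : Continuous ρ) (hρu : ∀ x, ρ x ∈ Matrix.unitaryGroup (Fin N) ℂ) {β : ℝ} (hβ : 0 ≤ β)
    (a : ℕ) {b : ℕ} (hb : 2 ≤ b) (c d : ℕ) :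
    wilsonFinTorusPartition ρ β a (2 * b) c d ≤ wilsonFinTorusPartition ρ β a b c d ^ 2 := by
  rw [wilsonFinTorusPartition_swap01 ρ hρ β a (2 * b) c d, wilsonFinTorusPartition_swap01 ρ hρ β a b c d]
  exact Z_double0_le_sq hρ hρu hβ hb a c d

theorem Z_double2_le_sq (hρ : Continuous ρ) (hρu : ∀ x, ρ x ∈ Matrix.unitaryGroup (Fin N) ℂ) {β : ℝ} (hβ : 0 ≤ β)
    (a b : ℕ) {c : ℕ} (hc : 2 ≤ c) (d : ℕ) :
    wilsonFinTorusPartition ρ β a b (2 * c) d ≤ wilsonFinTorusPartition ρ β a b c d ^ 2 := by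
  rw [wilsonFinTorusPartition_swap02 ρ hρ β a b (2 * c) d, wilsonFinTorusPartition_swap02 ρ hρ β a b c d]
  exact Z_double0_le_sq hρ hρu hβ hc b a d

/-! ### Doubling laws for the flux weight -/

theorem u0_transverse1 (hρ : Continuous ρ) (hρu : ∀ x, ρ x ∈ Matrix.unitaryGroup (Fin N) ℂ) {β : ℝ} (hβ : 0 ≤ β)
    {g : G} (hg : g ∈ Subgroup.center G) {n : ℕ} (hn : 0 < n) (a : ℕ) {b : ℕ} (hb : 2 ≤ b) (c : ℕ) {d : ℕ}
    (hd : 2 ≤ d) {e : ℝ} (he : 0 ≤ e) (hres : (1 - e) * P0 ρ β g n a b c d ^ 2 ≤ P0 ρ β g n a (2 * b) c d) :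
    u0 ρ β g n a (2 * b) c d ≤ 2 * u0 ρ β g n a b c d + e :=
  arith_transverse (wilsonFinTorusPartition_pos hρ β a b c d) (wilsonFinTorusPartition_pos hρ β a (2 * b) c d)
    (P0_pos hρ β g hn a b c d).le (P0_le_Z hρ hρu hβ hg hn a b c hd) (P0_pos hρ β g hn a (2 * b) c d).le he
    (Z_double1_le_sq hρ hρu hβ a hb c d) hres

theorem u0_transverse2 (hρ : Continuous ρ) (hρu : ∀ x, ρ x ∈ Matrix.unitaryGroup (Fin N) ℂ) {β : ℝ} (hβ : 0 ≤ β)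
    {g : G} (hg : g ∈ Subgroup.center G) {n : ℕ} (hn : 0 < n) (a b : ℕ) {c : ℕ} (hc : 2 ≤ c) {d : ℕ}
    (hd : 2 ≤ d) {e : ℝ} (he : 0 ≤ e) (hres : (1 - e) * P0 ρ β g n a b c d ^ 2 ≤ P0 ρ β g n a b (2 * c) d) :
    u0 ρ β g n a b (2 * c) d ≤ 2 * u0 ρ β g n a b c d + e :=
  arith_transverse (wilsonFinTorusPartition_pos hρ β a b c d) (wilsonFinTorusPartition_pos hρ β a b (2 * c) d)
    (P0_pos hρ β g hn a b c d).le (P0_le_Z hρ hρu hβ hg hn a b c hd) (P0_pos hρ β g hn a b (2 * c) d).le he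
    (Z_double2_le_sq hρ hρu hβ a b hc d) hres

theorem u0_time_sq (hρ : Continuous ρ) {β : ℝ} {g : G} {n : ℕ} (hSub : FluxSubmultAt ρ β g n)
    {a b c d : ℕ} (ha : 1 ≤ a) (hb : 1 ≤ b) (hc : 1 ≤ c) (hd : 2 ≤ d) {𝒩 : ℝ}
    (hres : wilsonFinTorusPartition ρ β a b c d ^ 2 ≤ 𝒩 * wilsonFinTorusPartition ρ β a b c (2 * d)) :
    u0 ρ β g n a b c (2 * d) ≤ u0 ρ β g n a b c d ^ 2 * 𝒩 :=
  arith_inplane (wilsonFinTorusPartition_pos hρ β a b c d) (wilsonFinTorusPartition_pos hρ β a b c (2 * d))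
    (hSub a b c d ha hb hc hd) hres

theorem u0_space_sq (hρ : Continuous ρ) {β : ℝ} {g : G} {n : ℕ} (hSub : FluxSubmultAt ρ β g⁻¹ n)
    {a b c d : ℕ} (ha : 2 ≤ a) (hb : 1 ≤ b) (hc : 1 ≤ c) (hd : 1 ≤ d) {𝒩 : ℝ}
    (hres : wilsonFinTorusPartition ρ β a b c d ^ 2 ≤ 𝒩 * wilsonFinTorusPartition ρ β (2 * a) b c d) :
    u0 ρ β g n (2 * a) b c d ≤ u0 ρ β g n a b c d ^ 2 * 𝒩 := by
  rw [u0_swap03 hρ β g n (2 * a), u0_swap03 hρ β g n a]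
  rw [wilsonFinTorusPartition_swap03 ρ hρ β a b c d, wilsonFinTorusPartition_swap03 ρ hρ β (2 * a) b c d] at hres
  exact u0_time_sq hρ hSub hd hb hc ha hres

theorem u0_octave (hρ : Continuous ρ) (hρu : ∀ x, ρ x ∈ Matrix.unitaryGroup (Fin N) ℂ) {β : ℝ} (hβ : 0 ≤ β)
    {g : G} (hg : g ∈ Subgroup.center G) {n : ℕ} (hn : 0 < n) (hSub : FluxSubmultAt ρ β g n)
    (hSubInv : FluxSubmultAt ρ β g⁻¹ n) {L t : ℕ} (hL : 2 ≤ L) (ht : 2 ≤ t) {e : ℝ} (he : 0 ≤ e)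
    (R1 : wilsonFinTorusPartition ρ β L L L t ^ 2 ≤ 2 * wilsonFinTorusPartition ρ β L L L (2 * t))
    (R2 : (1 - (u0 ρ β g n L L L t + e)) * P0 ρ β g n L L L (2 * t) ^ 2 ≤ P0 ρ β g n L (2 * L) L (2 * t))
    (R3 : (1 - (u0 ρ β g n L L L t + e)) * P0 ρ β g n L (2 * L) L (2 * t) ^ 2 ≤
      P0 ρ β g n L (2 * L) (2 * L) (2 * t))
    (R4 : wilsonFinTorusPartition ρ β L (2 * L) (2 * L) (2 * t) ^ 2 ≤
      (6 / 5) * wilsonFinTorusPartition ρ β (2 * L) (2 * L) (2 * L) (2 * t)) :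
    u0 ρ β g n (2 * L) (2 * L) (2 * L) (2 * t) ≤
      (8 * u0 ρ β g n L L L t ^ 2 + 3 * u0 ρ β g n L L L t + 3 * e) ^ 2 * (6 / 5) := by
  have hL1 : 1 ≤ L := by omega
  have h2L : 1 ≤ 2 * L := by omega
  have h2t : 2 ≤ 2 * t := by omega
  have hu : 0 ≤ u0 ρ β g n L L L t := u0_nonneg hρ hρu hβ hg hn L L L ht
  have hue : 0 ≤ u0 ρ β g n L L L t + e := add_nonneg hu he
  have h1 := u0_time_sq hρ hSub hL1 hL1 hL1 ht R1
  have h2 := u0_transverse1 hρ hρu hβ hg hn L hL L h2t hue R2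
  have h3 := u0_transverse2 hρ hρu hβ hg hn L (2 * L) hL h2t hue R3
  have h4 := u0_space_sq hρ hSubInv hL h2L h2L (by omega : 1 ≤ 2 * t) R4
  have hu₃ : 0 ≤ u0 ρ β g n L (2 * L) (2 * L) (2 * t) := u0_nonneg hρ hρu hβ hg hn _ _ _ h2t
  exact arith_octave hu hu₃ he h1 h2 h3 h4

theorem coldDefect_le_of_neutralPure (hρ : Continuous ρ) (hρu : ∀ x, ρ x ∈ Matrix.unitaryGroup (Fin N) ℂ) {β : ℝ}
    (hβ : 0 ≤ β) {g : G} (hg : g ∈ Subgroup.center G) {n : ℕ} (hn : 0 < n) {t : ℕ} (ht : 2 ≤ t) {θ : ℝ} (hθ : 0 ≤ θ)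
    (hV : (1 - θ) * P0 ρ β g n (4 * t) (4 * t) (4 * t) t ^ 2 ≤ P0 ρ β g n (4 * t) (4 * t) (4 * t) (2 * t)) :
    coldDefect ρ β (4 * t) ≤ θ + 2 * u0 ρ β g n (4 * t) (4 * t) (4 * t) t := by
  have h4 : 4 * t / 4 = t := by omega
  unfold coldDefect u0
  rw [h4]
  exact arith_seam (wilsonFinTorusPartition_pos hρ β _ _ _ _) (P0_pos hρ β g hn _ _ _ _).le
    (P0_le_Z hρ hρu hβ hg hn _ _ _ ht) (P0_le_Z hρ hρu hβ hg hn _ _ _ (by omega)) hθ hV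

end Currency

/-! ## §1 Pieces (typed Props) -/

/-- **(S) SEED** — one 1/32-margin-confined cold 4:1 box, cofinally, pinned, 4 ∣ L. -/
def Seed : Prop :=
  ∀ (G : Type) [Group G] [TopologicalSpace G] [IsTopologicalGroup G] [CompactSpace G],
    IsCompactSimpleLieGroup G → SimplyConnectedSpace G →
    letI : MeasurableSpace G := borel G
    haveI : BorelSpace G := ⟨rfl⟩
    ∀ (r : LatticeRep G) (a : ℝ → ℝ), (∀ β, 0 < a β) → Tendsto a atTop (𝓝 0) → LowerBounds G r a →
      ∃ T : ℝ, ∀ β₁ : ℝ, ∃ β : ℝ, β₁ ≤ β ∧ ∃ L : ℕ, 8 ≤ L ∧ 4 ∣ L ∧ a β * (L : ℝ) ≤ T ∧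
        ∀ z : Fin 4 → G, (∀ μ, z μ ∈ Subgroup.center G) →
          1 - wilsonFinTorusTwistedPartition r.ρ β z L L L (L / 4) / wilsonFinTorusPartition r.ρ β L L L (L / 4) ≤
            (1 / 32 : ℝ)

/-- **Centre-adapted spectral data** of the slice a×b×c for (ρ, β, g, n). -/
def AdaptedSpectralDataAt {G : Type} [Group G] [TopologicalSpace G] [IsTopologicalGroup G] [CompactSpace G]
    [MeasurableSpace G] [BorelSpace G] {N : ℕ} (ρ : G →* Matrix (Fin N) (Fin N) ℂ) (β : ℝ) (g : G) (n : ℕ)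
    (a b c : ℕ) : Prop :=
  ∃ (ι : Type) (lam w : ι → ℝ), (∀ i, 0 ≤ lam i) ∧ (∀ i, w i = 0 ∨ w i = 1) ∧
    (∀ m : ℕ, HasSum (fun i => lam i ^ (m + 2)) (wilsonFinTorusPartition ρ β a b c (m + 2))) ∧
    (∀ m : ℕ, HasSum (fun i => lam i ^ (m + 2) * w i) (P0 ρ β g n a b c (m + 2)))

/-- **Adapted spectral data exists for all boxes** — the M-class stub. -/
def AdaptedSpectralData : Prop :=
  ∀ (G : Type) [Group G] [TopologicalSpace G] [IsTopologicalGroup G] [CompactSpace G],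
    IsCompactSimpleLieGroup G → SimplyConnectedSpace G →
    letI : MeasurableSpace G := borel G
    haveI : BorelSpace G := ⟨rfl⟩
    ∀ (r : LatticeRep G) (β : ℝ), 0 ≤ β → ∀ g ∈ Subgroup.center G, ∀ n : ℕ, 0 < n → g ^ n = 1 →
      ∀ a b c : ℕ, 1 ≤ a → 1 ≤ b → 1 ≤ c → AdaptedSpectralDataAt r.ρ β g n a b c

/-- **(Σ) FLUX-SECTOR SUB-MULTIPLICATIVITY** — derived from adapted spectral data. -/
def FluxSubmult : Prop :=
  ∀ (G : Type) [Group G] [TopologicalSpace G] [IsTopologicalGroup G] [CompactSpace G],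
    IsCompactSimpleLieGroup G → SimplyConnectedSpace G →
    letI : MeasurableSpace G := borel G
    haveI : BorelSpace G := ⟨rfl⟩
    ∀ (r : LatticeRep G) (β : ℝ), 0 ≤ β → ∀ g ∈ Subgroup.center G, ∀ n : ℕ, 0 < n → g ^ n = 1 →
      FluxSubmultAt r.ρ β g n

/-- **(R) RESIDUALS** — ladder tolerances above a margin-confined box. -/
def Residuals : Prop :=
  ∀ (G : Type) [Group G] [TopologicalSpace G] [IsTopologicalGroup G] [CompactSpace G],
    IsCompactSimpleLieGroup G → SimplyConnectedSpace G →
    letI : MeasurableSpace G := borel G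
    haveI : BorelSpace G := ⟨rfl⟩
    ∀ (r : LatticeRep G), ∀ g ∈ Subgroup.center G, g ≠ 1 → ∀ n : ℕ, 0 < n → g ^ n = 1 →
      ∃ β₀ : ℝ, ∀ β : ℝ, β₀ ≤ β → ∀ t : ℕ, 2 ≤ t →
        u0 r.ρ β g n (4 * t) (4 * t) (4 * t) t ≤ 1 / 32 →
          wilsonFinTorusPartition r.ρ β (4 * t) (4 * t) (4 * t) t ^ 2 ≤
              2 * wilsonFinTorusPartition r.ρ β (4 * t) (4 * t) (4 * t) (2 * t) ∧
          (1 - (u0 r.ρ β g n (4 * t) (4 * t) (4 * t) t + ebar)) *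
              P0 r.ρ β g n (4 * t) (4 * t) (4 * t) (2 * t) ^ 2 ≤ P0 r.ρ β g n (4 * t) (2 * (4 * t)) (4 * t) (2 * t) ∧
          (1 - (u0 r.ρ β g n (4 * t) (4 * t) (4 * t) t + ebar)) *
              P0 r.ρ β g n (4 * t) (2 * (4 * t)) (4 * t) (2 * t) ^ 2 ≤
            P0 r.ρ β g n (4 * t) (2 * (4 * t)) (2 * (4 * t)) (2 * t) ∧
          wilsonFinTorusPartition r.ρ β (4 * t) (2 * (4 * t)) (2 * (4 * t)) (2 * t) ^ 2 ≤
            (6 / 5) * wilsonFinTorusPartition r.ρ β (2 * (4 * t)) (2 * (4 * t)) (2 * (4 * t)) (2 * t)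

/-- **(V) NEUTRAL PURITY** — gap of the neutral sector at deep confinement. -/
def NeutralPure : Prop :=
  ∀ (G : Type) [Group G] [TopologicalSpace G] [IsTopologicalGroup G] [CompactSpace G],
    IsCompactSimpleLieGroup G → SimplyConnectedSpace G →
    letI : MeasurableSpace G := borel G
    haveI : BorelSpace G := ⟨rfl⟩
    ∀ (r : LatticeRep G), ∀ g ∈ Subgroup.center G, g ≠ 1 → ∀ n : ℕ, 0 < n → g ^ n = 1 →
      ∃ β₀ : ℝ, ∀ β : ℝ, β₀ ≤ β → ∀ t : ℕ, 2 ≤ t →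
        u0 r.ρ β g n (4 * t) (4 * t) (4 * t) t ≤ θV →
          (1 - θN) * P0 r.ρ β g n (4 * t) (4 * t) (4 * t) t ^ 2 ≤ P0 r.ρ β g n (4 * t) (4 * t) (4 * t) (2 * t)

/-- **(CF) CENTRE-FREE RESIDUAL** — PXcof(1/24) for G₂/F₄/E₈ (X11). -/
def CentreFreePX : Prop :=
  ∀ (G : Type) [Group G] [TopologicalSpace G] [IsTopologicalGroup G] [CompactSpace G],
    IsCompactSimpleLieGroup G → SimplyConnectedSpace G → Subgroup.center G = ⊥ →
    letI : MeasurableSpace G := borel G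
    haveI : BorelSpace G := ⟨rfl⟩
    ∀ (r : LatticeRep G) (a : ℝ → ℝ), (∀ β, 0 < a β) → Tendsto a atTop (𝓝 0) → LowerBounds G r a →
      ∃ T : ℝ, ∀ β₁ : ℝ, ∃ β : ℝ, β₁ ≤ β ∧ ∃ L : ℕ, 8 ≤ L ∧ a β * (L : ℝ) ≤ T ∧ coldDefect r.ρ β L ≤ (1 / 24 : ℝ)

/-! ## §2 Stubs (sorries ONLY here; v1_2: five — (Σ′) is discharged below) -/

/-- **stub (S)** -/
theorem stub_seed : Seed := by sorry

/-- **(Σ′) — NO LONGER A STUB (v1_2)**: discharged by the helper lane ✓p818348 + ✓p818549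
(`Theorems.IRcofInplaneSquaringLadderLine.stub_adaptedSpectralData`, whose type δ-unfolds to this file's `AdaptedSpectralData`). -/
theorem stub_adaptedSpectralData : AdaptedSpectralData :=
  Theorems.IRcofInplaneSquaringLadderLine.stub_adaptedSpectralData

/-- **stub (R)** -/
theorem stub_residuals : Residuals := by sorry

/-- **stub (V)** -/
theorem stub_neutralPure : NeutralPure := by sorry

/-- **stub (CF)** — barrier import (X11). -/
theorem stub_centreFreePX : CentreFreePX := by sorry

/-- **stub (N)** — shared from line of record. -/
theorem stub_irnscCof : IRnscCof := by sorry

/-! ## §3 Proved: FluxSubmult from AdaptedSpectralData -/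

section Sigma

variable {G : Type} [Group G] [TopologicalSpace G] [IsTopologicalGroup G] [CompactSpace G]
  [MeasurableSpace G] [BorelSpace G] {N : ℕ}

/-- ★ **(Σ) from adapted spectral data (PROVED)**: the charged family aᵢ = λᵢ^d(1−wᵢ) has aᵢ² = λᵢ^{2d}(1−wᵢ),
so Z(2d) − P0(2d) = Σ aᵢ² ≤ (Σ aᵢ)² = (Z(d) − P0(d))². -/
theorem fluxSubmultAt_of_adapted {ρ : G →* Matrix (Fin N) (Fin N) ℂ} {β : ℝ} {g : G} {n : ℕ}
    (h : ∀ a b c : ℕ, 1 ≤ a → 1 ≤ b → 1 ≤ c → AdaptedSpectralDataAt ρ β g n a b c) :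
    FluxSubmultAt ρ β g n := by
  intro a b c d ha hb hc hd
  obtain ⟨ι, lam, w, hlam, hw, hZ, hP⟩ := h a b c ha hb hc
  obtain ⟨m, rfl⟩ : ∃ m, d = m + 2 := ⟨d - 2, by omega⟩
  have hw01 : ∀ i, 0 ≤ 1 - w i ∧ (1 - w i) ^ 2 = 1 - w i := by
    intro i
    rcases hw i with h0 | h1
    · rw [h0]; norm_num
    · rw [h1]; norm_num
  have hA : HasSum (fun i => lam i ^ (m + 2) * (1 - w i))
      (wilsonFinTorusPartition ρ β a b c (m + 2) - P0 ρ β g n a b c (m + 2)) := by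
    have := (hZ m).sub (hP m); refine this.congr_fun fun i => ?_; ring
  have hB : HasSum (fun i => (lam i ^ (m + 2) * (1 - w i)) ^ 2)
      (wilsonFinTorusPartition ρ β a b c (2 * (m + 2)) - P0 ρ β g n a b c (2 * (m + 2))) := by
    have h2 := (hZ (2 * m + 2)).sub (hP (2 * m + 2))
    rw [show 2 * m + 2 + 2 = 2 * (m + 2) from by ring] at h2
    refine h2.congr_fun fun i => ?_
    show (lam i ^ (m + 2) * (1 - w i)) ^ 2 = lam i ^ (2 * m + 2 + 2) - lam i ^ (2 * m + 2 + 2) * w i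
    rw [mul_pow, (hw01 i).2, ← pow_mul, show (m + 2) * 2 = 2 * m + 2 + 2 from by ring]; ring
  exact hasSum_sq_le_sq (fun i => mul_nonneg (pow_nonneg (hlam i) _) (hw01 i).1) hA hB

end Sigma

/-- ★ **FluxSubmult from AdaptedSpectralData (PROVED)**. -/
theorem fluxSubmult_of_adaptedSpectralData (h : AdaptedSpectralData) : FluxSubmult := by
  intro G _ _ _ _ hG hsc
  letI : MeasurableSpace G := borel G
  haveI : BorelSpace G := ⟨rfl⟩
  intro r β hβ g hg n hn hgn
  exact fluxSubmultAt_of_adapted fun a b c ha hb hc => h G hG hsc r β hβ g hg n hn hgn a b c ha hb hc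

/-! ## §4 The β = 0 toy (rule (N); crit-1 CUT-9 ‼T): (Σ) holds at β = 0 — every partition function is 1. -/

section Toy

variable {G : Type} [Group G] [TopologicalSpace G] [IsTopologicalGroup G] [CompactSpace G]
  [MeasurableSpace G] [BorelSpace G] {N : ℕ}

/-- **(N) toy**: `FluxSubmultAt ρ 0 g n` (all `Z = P0 = 1`, `0 ≤ 0`). -/
theorem fluxSubmultAt_beta_zero (ρ : G →* Matrix (Fin N) (Fin N) ℂ) (g : G) {n : ℕ} (hn : 0 < n) :
    FluxSubmultAt ρ 0 g n := by
  have hZ : ∀ a b c d : ℕ, wilsonFinTorusPartition ρ 0 a b c d = 1 := by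
    intro a b c d; simp [wilsonFinTorusPartition]
  have hT : ∀ (z : Fin 4 → G) (a b c d : ℕ), wilsonFinTorusTwistedPartition ρ 0 z a b c d = 1 := by
    intro z a b c d; simp [wilsonFinTorusTwistedPartition]
  have hP : ∀ a b c d : ℕ, P0 ρ 0 g n a b c d = 1 := by
    intro a b c d
    unfold P0
    simp only [hT, Finset.sum_const, Finset.card_univ, Fintype.card_fin, nsmul_eq_mul, mul_one]
    have hn' : (n : ℝ) ≠ 0 := by exact_mod_cast hn.ne'
    exact inv_mul_cancel₀ hn'
  intro a b c d _ _ _ _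
  rw [hZ, hZ, hP, hP]
  norm_num

end Toy

/-! ## §5 Composition: PXcof(1/24) from the pieces, IRcof from PXcof + N_cof -/

/-- ★★★ **`Seed → FluxSubmult → Residuals → NeutralPure → CentreFreePX → PXcof(1/24)`** (PROVED plumbing). Nontrivial centre:
pick a central `g ≠ 1` (finite order, `CentreFinite`); at the seed's pinned `1/32`-margin-confined box `(4t)³×t` the flux weight is
`u_0 ≤ 1/32`; by `u0_octave` + (R) with tolerance `ebar = 10⁻⁷`, `u_{k+1} ≤ gmap u_k ebar` along the boxes `(2ᵏ·4t)³ × 2ᵏt`,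
and the five QUADRATIC rows (`rows`) give `u_1 ≤ 1/80, u_2 ≤ 1/500, u_3 ≤ 1/20000, u_4 ≤ 3·10⁻⁸, u_5 ≤ 2·10⁻¹³ ≤ θV = 10⁻¹²`;
(V) and the seam give `coldDefect(2⁵·4t) ≤ θN + 2u_5 ≤ 1/24` (`seam_closes`), pinned by `T = 32·T₀`.
Trivial centre: (CF). -/
theorem pxcof24_of_pieces (hS : Seed) (hSub : FluxSubmult) (hR : Residuals) (hV : NeutralPure) (hCF : CentreFreePX) :
    PXcof (1 / 24) := by
  intro G _ _ _ _ hG hsc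
  letI : MeasurableSpace G := borel G
  haveI : BorelSpace G := ⟨rfl⟩
  intro r a ha ha0 hlb
  haveI : SecondCountableTopology G :=
    (r.continuous.isClosedEmbedding r.injective).isEmbedding.secondCountableTopology
  by_cases hbot : Subgroup.center G = ⊥
  · exact hCF G hG hsc hbot r a ha ha0 hlb
  -- a nontrivial central element of finite order
  obtain ⟨g, hg, hg1⟩ : ∃ g ∈ Subgroup.center G, g ≠ 1 := by
    by_contra h
    push Not at h
    exact hbot ((Subgroup.eq_bot_iff_forall _).2 h)
  haveI : Finite (Subgroup.center G) := CentreFinite.finite_center_of_isCompactSimpleLieGroup hG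
  set n : ℕ := orderOf (⟨g, hg⟩ : Subgroup.center G) with hn_def
  have hn : 0 < n := (isOfFinOrder_of_finite (⟨g, hg⟩ : Subgroup.center G)).orderOf_pos
  have hgn : g ^ n = 1 := by
    have h := pow_orderOf_eq_one (⟨g, hg⟩ : Subgroup.center G)
    rw [← hn_def] at h
    have h' := congrArg Subtype.val h
    simpa using h'
  have hg' : g⁻¹ ∈ Subgroup.center G := Subgroup.inv_mem _ hg
  have hgn' : g⁻¹ ^ n = 1 := by rw [inv_pow, hgn, inv_one]
  -- the thresholds of (R) and (V), the seed
  obtain ⟨βR, hβR⟩ := hR G hG hsc r g hg hg1 n hn hgn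
  obtain ⟨βV, hβV⟩ := hV G hG hsc r g hg hg1 n hn hgn
  obtain ⟨T₀, hseed⟩ := hS G hG hsc r a ha ha0 hlb
  refine ⟨32 * T₀, fun β₁ => ?_⟩
  obtain ⟨β, hβ₁, L, hL8, ⟨t, rfl⟩, hpin, hmargin⟩ := hseed (max (max β₁ 0) (max βR βV))
  have hβ0 : 0 ≤ β := le_trans (le_max_right _ _) ((le_max_left _ _).trans hβ₁)
  have hβR' : βR ≤ β := le_trans (le_max_left _ _) ((le_max_right _ _).trans hβ₁)
  have hβV' : βV ≤ β := le_trans (le_max_right _ _) ((le_max_right _ _).trans hβ₁)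
  have ht : 2 ≤ t := by omega
  have hρ := r.continuous
  have hρu := r.mem_unitary
  -- the flux weight along the ladder of boxes `(4·2ᵏt)³ × 2ᵏt`
  set f : ℕ → ℝ := fun k => u0 r.ρ β g n (4 * (2 ^ k * t)) (4 * (2 ^ k * t)) (4 * (2 ^ k * t)) (2 ^ k * t) with hf
  have h4t : 4 * t / 4 = t := by omega
  have hf0 : f 0 ≤ 1 / 32 := by
    simp only [hf, pow_zero, one_mul]
    refine u0_le_of_margins hρ β hg hn _ _ _ _ fun z hz => ?_
    have h := hmargin z hz
    rwa [h4t] at h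
  have hstep : ∀ k, f k ≤ 1 / 32 → f (k + 1) ≤ gmap (f k) ebar := by
    intro k hk
    have htk : 2 ≤ 2 ^ k * t := le_trans ht (Nat.le_mul_of_pos_left t (Nat.two_pow_pos k))
    obtain ⟨R1, R2, R3, R4⟩ := hβR β hβR' (2 ^ k * t) htk hk
    have hoct := u0_octave hρ hρu hβ0 hg hn (hSub G hG hsc r β hβ0 g hg n hn hgn) (hSub G hG hsc r β hβ0 g⁻¹ hg' n hn hgn')
      (L := 4 * (2 ^ k * t)) (t := 2 ^ k * t) (by omega) htk ebar_nonneg R1 R2 R3 R4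
    have e1 : 2 * (4 * (2 ^ k * t)) = 4 * (2 ^ (k + 1) * t) := by ring
    have e2 : 2 * (2 ^ k * t) = 2 ^ (k + 1) * t := by ring
    simp only [hf, gmap]
    rw [← e1, ← e2]
    exact hoct
  have hnn : ∀ k, 0 ≤ f k := fun k =>
    u0_nonneg hρ hρu hβ0 hg hn _ _ _ (le_trans ht (Nat.le_mul_of_pos_left t (Nat.two_pow_pos k)))
  -- the five QUADRATIC rows (crit-1 CUT-9 ‼V′): 1/32 ↦ 1/80 ↦ 1/500 ↦ 1/20000 ↦ 3·10⁻⁸ ↦ 2·10⁻¹³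
  have row : ∀ k (U U' : ℝ), f k ≤ U → U ≤ 1 / 32 → gmap U ebar ≤ U' → f (k + 1) ≤ U' := by
    intro k U U' hU hU32 hrow
    exact ((hstep k (hU.trans hU32)).trans (gmap_mono (hnn k) hU ebar_nonneg)).trans hrow
  obtain ⟨r1, r2, r3, r4, r5⟩ := rows
  have hf1 : f 1 ≤ 1 / 80 := row 0 _ _ hf0 le_rfl r1
  have hf2 : f 2 ≤ 1 / 500 := row 1 _ _ hf1 (by norm_num) r2
  have hf3 : f 3 ≤ 1 / 20000 := row 2 _ _ hf2 (by norm_num) r3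
  have hf4 : f 4 ≤ 3 / 10 ^ 8 := row 3 _ _ hf3 (by norm_num) r4
  have hf5' : f 5 ≤ 2 / 10 ^ 13 := row 4 _ _ hf4 (by norm_num) r5
  -- five octaves up: flux weight ≤ θ_V, neutral purity, the seam
  have hf5 : f 5 ≤ θV := hf5'.trans seam_closes.2
  have ht5 : 2 ≤ 2 ^ 5 * t := by omega
  have hVt := hβV β hβV' (2 ^ 5 * t) ht5 hf5
  have hseam := coldDefect_le_of_neutralPure hρ hρu hβ0 hg hn ht5 θN_nonneg hVt
  refine ⟨β, le_trans (le_max_left _ _) ((le_max_left _ _).trans hβ₁), 4 * (2 ^ 5 * t), by omega, ?_, ?_⟩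
  · have e3 : ((4 * (2 ^ 5 * t) : ℕ) : ℝ) = 32 * ((4 * t : ℕ) : ℝ) := by push_cast; ring
    rw [e3, ← mul_assoc, mul_comm (a β) 32, mul_assoc]
    exact mul_le_mul_of_nonneg_left hpin (by norm_num)
  · have : θN + 2 * f 5 ≤ 1 / 24 := by linarith [seam_closes.1]
    exact hseam.trans this

/-- ★★★ **The crux BY NAME**: `… → IRnscCof → Summit.QuantumFields.YangMills.Theses.BalabanLadder.IRcof`. -/
theorem IRcof_of (hS : Seed) (hASD : AdaptedSpectralData) (hR : Residuals) (hV : NeutralPure)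
    (hCF : CentreFreePX) (hN : IRnscCof) : Summit.QuantumFields.YangMills.Theses.BalabanLadder.IRcof := by
  have hSub : FluxSubmult := fluxSubmult_of_adaptedSpectralData hASD
  have hP := pxcof24_of_pieces hS hSub hR hV hCF
  intro G _ _ _ _ hG
  letI : MeasurableSpace G := borel G
  haveI : BorelSpace G := ⟨rfl⟩
  intro r a ha ha0 hlb
  by_cases hsc : SimplyConnectedSpace G
  · obtain ⟨T, hcof⟩ := hP G hG hsc r a ha ha0 hlb
    exact cofinalGapOn_of_pinnedExits r a ha ha0 hcof
  · exact hN G hG hsc r a ha ha0 hlb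

/-- **The crux from the five stubs** (and the discharged (Σ′)). -/
theorem IRcof_of_stubs : Summit.QuantumFields.YangMills.Theses.BalabanLadder.IRcof :=
  IRcof_of stub_seed stub_adaptedSpectralData stub_residuals stub_neutralPure stub_centreFreePX stub_irnscCof

end Summit.QuantumFields.YangMills.Cruxes.IRcof.Lines.InplaneSquaringLadder

end
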